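/-
Copyright (c) 2026. All rights reserved.
Released under Apache 2.0 license as described in the file LICENSE.
Authors: HodgeCM publication cell (pub-hodgecm), model-construction sub-cell, construction prover `mc-theta-1` (gen 5).
-/
import Mathlib.Analysis.Distribution.SchwartzSpace.Basic
import Mathlib.Analysis.Calculus.FDeriv.Partial
import Mathlib.Analysis.Calculus.ContDiff.Comp
import Mathlib.Analysis.Calculus.Deriv.Slope
import Mathlib.Analysis.SpecialFunctions.ExpDeriv
import HarnessLib

/-!
# Differentiable one-parameter operator families on Schwartz space and smoothness of word maps

Topic `Analysis/SegalBargmann`; namespace `Literature.Analysis.SegalBargmann`.  KERNEL ONLY (0 records).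

Let `D` be a real normed space and `𝓢 = 𝓢(D, ℂ)` its Schwartz space (Fréchet topology of the seminorms
`p_{k,l}`).  A family `U : ℝ → (𝓢 →L[ℂ] 𝓢)` with *generator* `G : 𝓢 →L[ℂ] 𝓢` is a **smooth one-parameter
family** (`IsSmoothOneParam U G`) when it is a one-parameter group (`U 0 = 1`, `U (s + t) = U s ∘ U t`), is
strongly differentiable at `0` with derivative `G` (`h⁻¹ • (U h f - f) → G f` in `𝓢` as `h → 0`, `h ≠ 0`),
and is *locally equicontinuous in seminorm form*: for some `δ > 0`, every seminorm of `U t f`, `|t| ≤ δ`, is bounded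
by finitely many seminorms of `f` uniformly in `t` (`IsSeminormBounded`; by the group law the same then holds on every
compact time interval, `IsSmoothOneParam.bound_Icc`).  These are exactly the data delivered, for the
one-parameter subgroups of the metaplectic group acting on `𝓢(ℝ^σ)`, by the files
`SegalBargmann/HermiteMultiplierDerivative`, `…/HermiteMultiplierStrongContinuity` (compact torus) and
`RepresentationTheory/KonnoKonno2007/JunctionHyperbolicDerivative`, `…/JunctionHyperbolicFamily` (hyperbolic
one-parameter groups).

Main results (all elementary; `V` a real normed space, `T : 𝓢 →L[ℝ] V`, `Φ ∈ 𝓢`):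

* `IsSmoothOneParam.tendsto_apply₂`, `….continuous_apply₂` — joint continuity `(s, Ψ) ↦ U s Ψ` along filters;
  `IsSmoothOneParam.hasDerivAt_apply` — `d/ds T (U s f) = T (U s (G f))` at every `s`.
* closure: `IsSmoothOneParam.const_id`, `.conj` (conjugation by a topological automorphism of `𝓢`),
  `.rescale` (`s ↦ U (c s)`), `.phase` (`s ↦ e^{iλs} U s`).
* **Words.**  A `SmoothLetter` is `ℓ = (A, U, G, B)` with `IsSmoothOneParam U G` and fixed `A, B : 𝓢 →L[ℂ] 𝓢`,
  acting at time `s` by `ℓ.op s = A ∘ U s ∘ B`; for a word `w : Fin n → SmoothLetter` the operator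
  `wordOp n w t = ∏ᵢ (w i).op (t i)` (`t : Fin n → ℝ`, ordered product).  Then
  `hasFDerivAt_wordOp_apply`: `t ↦ T (wordOp n w t Φ)` is Fréchet differentiable at every `t ∈ ℝⁿ` with
  derivative `v ↦ ∑ᵢ vᵢ • T (wordOp n w⁽ⁱ⁾ t Φ)`, where `w⁽ⁱ⁾` replaces the letter `(A, U, G, B)` in position `i` by
  `(A, U, G, G ∘ B)`; consequently (`contDiff_wordOp_apply`) it is `C^∞`.

The proof of `hasFDerivAt_wordOp_apply` is induction on the length: the first coordinate is a one-parameter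
partial derivative (`hasDerivAt_apply`), the remaining ones are the induction hypothesis applied to the functional
`T ∘ (w 0).op (t 0)`, both partial derivatives are jointly continuous by `continuous_apply₂`, and a map on a
product with continuous partial differentials is (strictly) differentiable — R. Coleman, *Calculus on Normed Vector
Spaces*, Universitext, Springer 2012, Thm. 3.6 and Cor. 3.4 (pp. 61–62) [Coleman2012], in Mathlib's form
`hasStrictFDerivAt_uncurry_coprod`; the `C^k` bootstrap is [Coleman2012, §4.8 (pp. 82–84)].  The application in
view is the classical fact that matrix coefficients `g ↦ T (ω(g) Φ)` of a representation on its space of smooth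
vectors are smooth in coordinates of the second kind `g = ∏ exp (tᵢ Xᵢ)`; we know no reference for the
statements in the present operator-family form (`folklore`).

References: [Coleman2012] Thm. 3.6, Cor. 3.4, §4.8.
-/

set_option autoImplicit false

noncomputable section

open Filter Topology SchwartzMap
open scoped SchwartzMap ContDiff

namespace Literature.Analysis.SegalBargmann

variable {D : Type*} [NormedAddCommGroup D] [NormedSpace ℝ D]

section SeminormBounded

/-- A set `𝓕` of continuous endomorphisms of `𝓢(D, ℂ)` is **bounded in seminorm form** (equicontinuous):
every Schwartz seminorm of `A f`, `A ∈ 𝓕`, is bounded by a fixed finite sum of Schwartz seminorms of `f`,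
uniformly in `A ∈ 𝓕`. [folklore] -/
def IsSeminormBounded (𝓕 : Set (𝓢(D, ℂ) →L[ℂ] 𝓢(D, ℂ))) : Prop :=
  ∀ i : ℕ × ℕ, ∃ (s : Finset (ℕ × ℕ)) (C : ℝ), 0 ≤ C ∧ ∀ A ∈ 𝓕, ∀ f : 𝓢(D, ℂ),
    schwartzSeminormFamily ℂ D ℂ i (A f) ≤ C * ∑ j ∈ s, schwartzSeminormFamily ℂ D ℂ j f

/-- A finite sup of Schwartz seminorms is bounded by the corresponding finite sum. [folklore] -/
theorem finset_sup_schwartzSeminormFamily_le_sum (s : Finset (ℕ × ℕ)) (f : 𝓢(D, ℂ)) :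
    (s.sup (schwartzSeminormFamily ℂ D ℂ)) f ≤ ∑ j ∈ s, schwartzSeminormFamily ℂ D ℂ j f :=
  Seminorm.finset_sup_apply_le (Finset.sum_nonneg fun j _ => apply_nonneg (schwartzSeminormFamily ℂ D ℂ j) f)
    fun _ hj => Finset.single_le_sum (fun m _ => apply_nonneg (schwartzSeminormFamily ℂ D ℂ m) f) hj

/-- A single continuous operator is bounded in seminorm form. [folklore] -/
theorem isSeminormBounded_singleton (A : 𝓢(D, ℂ) →L[ℂ] 𝓢(D, ℂ)) : IsSeminormBounded ({A} : Set _) := by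
  intro i
  set q : Seminorm ℂ 𝓢(D, ℂ) := (schwartzSeminormFamily ℂ D ℂ i).comp (A : 𝓢(D, ℂ) →ₗ[ℂ] 𝓢(D, ℂ)) with hq
  have hqc : Continuous q := ((schwartz_withSeminorms ℂ D ℂ).continuous_seminorm i).comp A.continuous
  obtain ⟨s, C, -, hle⟩ := Seminorm.bound_of_continuous (schwartz_withSeminorms ℂ D ℂ) q hqc
  refine ⟨s, C, C.coe_nonneg, ?_⟩
  intro B hB f
  rw [Set.mem_singleton_iff] at hB
  subst hB
  calc schwartzSeminormFamily ℂ D ℂ i (B f) = q f := rfl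
    _ ≤ (C • s.sup (schwartzSeminormFamily ℂ D ℂ)) f := hle f
    _ = C * (s.sup (schwartzSeminormFamily ℂ D ℂ)) f := by simp [NNReal.smul_def]
    _ ≤ C * ∑ j ∈ s, schwartzSeminormFamily ℂ D ℂ j f := by
        gcongr; exact finset_sup_schwartzSeminormFamily_le_sum s f

/-- A subfamily of a seminorm-bounded family is seminorm-bounded. [folklore] -/
theorem IsSeminormBounded.mono {𝓕 𝓖 : Set (𝓢(D, ℂ) →L[ℂ] 𝓢(D, ℂ))} (h : IsSeminormBounded 𝓕) (h' : 𝓖 ⊆ 𝓕) :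
    IsSeminormBounded 𝓖 := fun i => by
  obtain ⟨s, C, hC, hb⟩ := h i
  exact ⟨s, C, hC, fun A hA f => hb A (h' hA) f⟩

/-- Composition of two bounded sets of operators is bounded. [folklore] -/
theorem IsSeminormBounded.comp {𝓕 𝓖 : Set (𝓢(D, ℂ) →L[ℂ] 𝓢(D, ℂ))} (h : IsSeminormBounded 𝓕)
    (h' : IsSeminormBounded 𝓖) :
    IsSeminormBounded (Set.image2 (fun A B => A.comp B) 𝓕 𝓖) := by
  intro i
  obtain ⟨s₁, C₁, hC₁, h₁⟩ := h i
  choose s₂ C₂ hC₂ h₂ using h'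
  refine ⟨s₁.biUnion s₂, C₁ * ∑ j ∈ s₁, C₂ j, mul_nonneg hC₁ (Finset.sum_nonneg fun j _ => hC₂ j), ?_⟩
  rintro _ ⟨A, hA, B, hB, rfl⟩ f
  have hstep : ∀ j ∈ s₁, schwartzSeminormFamily ℂ D ℂ j (B f) ≤
      C₂ j * ∑ m ∈ s₁.biUnion s₂, schwartzSeminormFamily ℂ D ℂ m f := fun j hj =>
    (h₂ j B hB f).trans (mul_le_mul_of_nonneg_left (Finset.sum_le_sum_of_subset_of_nonneg
      (Finset.subset_biUnion_of_mem s₂ hj) fun m _ _ => apply_nonneg (schwartzSeminormFamily ℂ D ℂ m) f) (hC₂ j))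
  calc schwartzSeminormFamily ℂ D ℂ i ((A.comp B) f)
        ≤ C₁ * ∑ j ∈ s₁, schwartzSeminormFamily ℂ D ℂ j (B f) := h₁ A hA (B f)
    _ ≤ C₁ * ∑ j ∈ s₁, (C₂ j * ∑ m ∈ s₁.biUnion s₂, schwartzSeminormFamily ℂ D ℂ m f) :=
        mul_le_mul_of_nonneg_left (Finset.sum_le_sum hstep) hC₁
    _ = (C₁ * ∑ j ∈ s₁, C₂ j) * ∑ m ∈ s₁.biUnion s₂, schwartzSeminormFamily ℂ D ℂ m f := by
        rw [← Finset.sum_mul]; ring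

/-- Scalar multiples by scalars of norm `≤ 1` of a bounded set form a bounded set. [folklore] -/
theorem IsSeminormBounded.unitSMul {𝓕 : Set (𝓢(D, ℂ) →L[ℂ] 𝓢(D, ℂ))} (h : IsSeminormBounded 𝓕) :
    IsSeminormBounded {B | ∃ c : ℂ, ‖c‖ ≤ 1 ∧ ∃ A ∈ 𝓕, B = c • A} := by
  intro i
  obtain ⟨s, C, hC, hb⟩ := h i
  refine ⟨s, C, hC, ?_⟩
  rintro _ ⟨c, hc, A, hA, rfl⟩ f
  calc schwartzSeminormFamily ℂ D ℂ i ((c • A) f) = ‖c‖ * schwartzSeminormFamily ℂ D ℂ i (A f) := by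
        rw [show (c • A) f = c • A f from rfl, map_smul_eq_mul]
    _ ≤ schwartzSeminormFamily ℂ D ℂ i (A f) :=
        mul_le_of_le_one_left (apply_nonneg (schwartzSeminormFamily ℂ D ℂ i) (A f)) hc
    _ ≤ C * ∑ j ∈ s, schwartzSeminormFamily ℂ D ℂ j f := hb A hA f

/-- Equicontinuity at `0`: operators from a bounded set applied to a null family give a null family. [folklore] -/
theorem IsSeminormBounded.tendsto_zero {𝓕 : Set (𝓢(D, ℂ) →L[ℂ] 𝓢(D, ℂ))} (h : IsSeminormBounded 𝓕)
    {X : Type*} {l : Filter X} {A : X → 𝓢(D, ℂ) →L[ℂ] 𝓢(D, ℂ)} (hA : ∀ᶠ x in l, A x ∈ 𝓕)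
    {g : X → 𝓢(D, ℂ)} (hg : Tendsto g l (𝓝 0)) : Tendsto (fun x => A x (g x)) l (𝓝 0) := by
  rw [(schwartz_withSeminorms ℂ D ℂ).tendsto_nhds _ 0]
  intro i ε hε
  obtain ⟨s, C, hC, hb⟩ := h i
  have hsum : Tendsto (fun x => C * ∑ j ∈ s, schwartzSeminormFamily ℂ D ℂ j (g x)) l (𝓝 0) := by
    have h1 : ∀ j, Tendsto (fun x => schwartzSeminormFamily ℂ D ℂ j (g x)) l (𝓝 0) := fun j => by
      have := (((schwartz_withSeminorms ℂ D ℂ).continuous_seminorm j).tendsto (0 : 𝓢(D, ℂ))).comp hg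
      rw [map_zero] at this
      exact this
    have h2 := (tendsto_finsetSum s fun j _ => h1 j).const_mul C
    rw [Finset.sum_const_zero, mul_zero] at h2
    exact h2
  filter_upwards [hA, (tendsto_order.1 hsum).2 ε hε] with x hx hx'
  rw [sub_zero]
  exact (hb (A x) hx (g x)).trans_lt hx'

/-- A seminorm-bounded family is uniformly continuous at a convergent net: `A (g x) - A f → 0` uniformly in `A ∈ 𝓕` whenever `g x → f`. [folklore] -/
theorem IsSeminormBounded.tendsto_sub {𝓕 : Set (𝓢(D, ℂ) →L[ℂ] 𝓢(D, ℂ))} (h : IsSeminormBounded 𝓕)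
    {X : Type*} {l : Filter X} {A : X → 𝓢(D, ℂ) →L[ℂ] 𝓢(D, ℂ)} (hA : ∀ᶠ x in l, A x ∈ 𝓕)
    {g : X → 𝓢(D, ℂ)} {g₀ : 𝓢(D, ℂ)} (hg : Tendsto g l (𝓝 g₀)) :
    Tendsto (fun x => A x (g x) - A x g₀) l (𝓝 0) := by
  have := h.tendsto_zero hA (tendsto_sub_nhds_zero_iff.mpr hg)
  simpa only [map_sub] using this

end SeminormBounded

section OneParam

/-- A **smooth one-parameter family** of operators on `𝓢(D, ℂ)` with generator `G`: a one-parameter group,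
strongly differentiable at `0` with derivative `G`, locally bounded in seminorm form. [folklore] -/
structure IsSmoothOneParam (U : ℝ → 𝓢(D, ℂ) →L[ℂ] 𝓢(D, ℂ)) (G : 𝓢(D, ℂ) →L[ℂ] 𝓢(D, ℂ)) : Prop where
  map_zero : U 0 = ContinuousLinearMap.id ℂ 𝓢(D, ℂ)
  map_add : ∀ s t : ℝ, U (s + t) = (U s).comp (U t)
  slope : ∀ f : 𝓢(D, ℂ), Tendsto (fun h : ℝ => h⁻¹ • (U h f - f)) (𝓝[≠] 0) (𝓝 (G f))
  bound : ∃ δ : ℝ, 0 < δ ∧ IsSeminormBounded (U '' Set.Icc (-δ) δ)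

/-- A continuous real-linear map into a normed space turns a curve in `𝓢` with a difference-quotient limit into
a curve with a derivative. [folklore] -/
theorem hasDerivAt_clm_apply_of_tendsto_slope {V : Type*} [NormedAddCommGroup V] [NormedSpace ℝ V]
    (T : 𝓢(D, ℂ) →L[ℝ] V) {c : ℝ → 𝓢(D, ℂ)} {c' : 𝓢(D, ℂ)} {t₀ : ℝ}
    (hc : Tendsto (slope c t₀) (𝓝[≠] t₀) (𝓝 c')) : HasDerivAt (fun t => T (c t)) (T c') t₀ := by
  rw [hasDerivAt_iff_tendsto_slope]
  have : slope (fun t => T (c t)) t₀ = fun t => T (slope c t₀ t) := by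
    funext t; simp only [slope_def_module, map_smul, map_sub]
  rw [this]
  exact (T.continuous.tendsto c').comp hc

namespace IsSmoothOneParam

variable {U : ℝ → 𝓢(D, ℂ) →L[ℂ] 𝓢(D, ℂ)} {G : 𝓢(D, ℂ) →L[ℂ] 𝓢(D, ℂ)}

/-- `U 0 f = f`. [folklore] -/
theorem apply_zero (hU : IsSmoothOneParam U G) (f : 𝓢(D, ℂ)) : U 0 f = f := by
  rw [hU.map_zero]; rfl

/-- The group law applied to a vector: `U (s + t) f = U s (U t f)`. [folklore] -/
theorem apply_add (hU : IsSmoothOneParam U G) (s t : ℝ) (f : 𝓢(D, ℂ)) : U (s + t) f = U s (U t f) := by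
  rw [hU.map_add]; rfl

/-- The operators of a one-parameter group commute: `U s ∘ U t = U t ∘ U s`. [folklore] -/
theorem comm (hU : IsSmoothOneParam U G) (s t : ℝ) : (U s).comp (U t) = (U t).comp (U s) := by
  rw [← hU.map_add, ← hU.map_add, add_comm]

/-- `U (-s)` is a two-sided inverse of `U s`. [folklore] -/
theorem comp_neg (hU : IsSmoothOneParam U G) (s : ℝ) :
    (U s).comp (U (-s)) = ContinuousLinearMap.id ℂ _ := by
  rw [← hU.map_add, add_neg_cancel, hU.map_zero]

/-- `U (-s) ∘ U s = id`. [folklore] -/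
theorem neg_comp (hU : IsSmoothOneParam U G) (s : ℝ) :
    (U (-s)).comp (U s) = ContinuousLinearMap.id ℂ _ := by
  rw [← hU.map_add, neg_add_cancel, hU.map_zero]

/-- Bounds on `[-Nδ, Nδ]` from bounds on `[-δ, δ]` and the group law. [folklore] -/
theorem bound_Icc_mul (hU : IsSmoothOneParam U G) {δ : ℝ} (hδ : 0 ≤ δ)
    (hb : IsSeminormBounded (U '' Set.Icc (-δ) δ)) :
    ∀ N : ℕ, IsSeminormBounded (U '' Set.Icc (-(N * δ)) (N * δ))
  | 0 => by
      refine (isSeminormBounded_singleton (ContinuousLinearMap.id ℂ 𝓢(D, ℂ))).mono ?_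
      rintro _ ⟨t, ht, rfl⟩
      have ht0 : t = 0 := by
        simp only [Nat.cast_zero, zero_mul, neg_zero, Set.mem_Icc] at ht; linarith [ht.1, ht.2]
      rw [ht0, hU.map_zero]; exact Set.mem_singleton _
  | N + 1 => by
      refine ((hU.bound_Icc_mul hδ hb N).comp hb).mono ?_
      rintro _ ⟨t, ht, rfl⟩
      simp only [Set.mem_Icc, Nat.cast_succ] at ht
      have hN : (0 : ℝ) < N + 1 := by positivity
      have hN0 : (0 : ℝ) ≤ N := Nat.cast_nonneg N
      -- `t = a + b` with `a = tN/(N+1) ∈ [-Nδ, Nδ]`, `b = t/(N+1) ∈ [-δ, δ]`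
      refine ⟨U (t * N / (N + 1)), Set.mem_image_of_mem U ?_, U (t / (N + 1)), Set.mem_image_of_mem U ?_, ?_⟩
      · rw [Set.mem_Icc, le_div_iff₀ hN, div_le_iff₀ hN]
        constructor <;> nlinarith [ht.1, ht.2]
      · rw [Set.mem_Icc, le_div_iff₀ hN, div_le_iff₀ hN]
        constructor <;> nlinarith [ht.1, ht.2]
      · show (U (t * N / (N + 1))).comp (U (t / (N + 1))) = U t
        rw [← hU.map_add, ← add_div, ← mul_add_one, mul_div_assoc, div_self hN.ne', mul_one]

/-- **Local equicontinuity on every compact time interval**: bounds in seminorm form on `[-R, R]`. [folklore] -/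
theorem bound_Icc (hU : IsSmoothOneParam U G) (R : ℝ) : IsSeminormBounded (U '' Set.Icc (-R) R) := by
  obtain ⟨δ, hδ, hb⟩ := hU.bound
  obtain ⟨N, hN⟩ := exists_nat_ge (R / δ)
  have hR : R ≤ N * δ := by rwa [div_le_iff₀ hδ] at hN
  exact (hU.bound_Icc_mul hδ.le hb N).mono (Set.image_mono (Set.Icc_subset_Icc (by linarith) hR))

/-- Strong continuity at `0`. [folklore] -/
theorem tendsto_apply_zero (hU : IsSmoothOneParam U G) (f : 𝓢(D, ℂ)) :
    Tendsto (fun h : ℝ => U h f) (𝓝 0) (𝓝 f) := by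
  have h0 : Tendsto (fun h : ℝ => h) (𝓝[≠] (0 : ℝ)) (𝓝 0) := tendsto_nhdsWithin_of_tendsto_nhds tendsto_id
  have h1 := h0.smul (hU.slope f)
  rw [zero_smul] at h1
  have h2 : (fun h : ℝ => U h f - f) =ᶠ[𝓝[≠] (0 : ℝ)] fun h => h • (h⁻¹ • (U h f - f)) :=
    eventually_mem_nhdsWithin.mono fun h hh => by
      dsimp only
      rw [smul_smul, mul_inv_cancel₀ (by simpa using hh), one_smul]
  have h3 : Tendsto (fun h : ℝ => U h f - f) (𝓝[≠] (0 : ℝ)) (𝓝 0) := h1.congr' h2.symm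
  have h4 : ContinuousAt (fun h : ℝ => U h f - f) 0 := by
    rw [← continuousWithinAt_compl_self]
    show Tendsto _ _ (𝓝 (U 0 f - f))
    rw [hU.apply_zero, sub_self]
    exact h3
  simpa [hU.apply_zero] using (h4.tendsto.add_const f)

/-- **Joint continuity along filters**: if `σ → s₀` and `Ψ → Ψ₀` then `U σ Ψ → U s₀ Ψ₀`. [folklore] -/
theorem tendsto_apply₂ (hU : IsSmoothOneParam U G) {X : Type*} {l : Filter X} {σ : X → ℝ}
    {Ψ : X → 𝓢(D, ℂ)} {s₀ : ℝ} {Ψ₀ : 𝓢(D, ℂ)} (hσ : Tendsto σ l (𝓝 s₀)) (hΨ : Tendsto Ψ l (𝓝 Ψ₀)) :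
    Tendsto (fun x => U (σ x) (Ψ x)) l (𝓝 (U s₀ Ψ₀)) := by
  have hδ : Tendsto (fun x => σ x - s₀) l (𝓝 0) := tendsto_sub_nhds_zero_iff.mpr hσ
  have hA : ∀ᶠ x in l, U (σ x - s₀) ∈ U '' Set.Icc (-1 : ℝ) 1 :=
    (hδ.eventually (Icc_mem_nhds (by norm_num) (by norm_num))).mono fun x hx => Set.mem_image_of_mem U hx
  have h1 : Tendsto (fun x => U (σ x - s₀) (Ψ x) - U (σ x - s₀) Ψ₀) l (𝓝 0) :=
    (hU.bound_Icc 1).tendsto_sub hA hΨ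
  have h2 : Tendsto (fun x => U (σ x - s₀) Ψ₀) l (𝓝 Ψ₀) := (hU.tendsto_apply_zero Ψ₀).comp hδ
  have h3 : Tendsto (fun x => U (σ x - s₀) (Ψ x)) l (𝓝 Ψ₀) := by
    simpa using h1.add h2
  have h4 := ((U s₀).continuous.tendsto Ψ₀).comp h3
  refine h4.congr fun x => ?_
  simp only [Function.comp_apply, ← hU.apply_add, add_sub_cancel]

/-- Joint continuity `(x ↦ U (σ x) (g x))` along continuous `σ`, `g`. [folklore] -/
theorem continuous_apply₂ (hU : IsSmoothOneParam U G) {X : Type*} [TopologicalSpace X] {σ : X → ℝ}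
    {Ψ : X → 𝓢(D, ℂ)} (hσ : Continuous σ) (hΨ : Continuous Ψ) : Continuous fun x => U (σ x) (Ψ x) :=
  continuous_iff_continuousAt.2 fun x => hU.tendsto_apply₂ (hσ.tendsto x) (hΨ.tendsto x)

/-- Strong continuity: `s ↦ U s f` is continuous. [folklore] -/
theorem continuous_apply (hU : IsSmoothOneParam U G) (f : 𝓢(D, ℂ)) : Continuous fun s => U s f :=
  hU.continuous_apply₂ continuous_id continuous_const

/-- The difference quotients of `s ↦ U s f` at `s` converge to `U s (G f)`. [folklore] -/
theorem tendsto_slope_apply (hU : IsSmoothOneParam U G) (f : 𝓢(D, ℂ)) (s : ℝ) :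
    Tendsto (_root_.slope (fun s' => U s' f) s) (𝓝[≠] s) (𝓝 (U s (G f))) := by
  have hshift : Tendsto (fun s' : ℝ => s' - s) (𝓝[≠] s) (𝓝[≠] 0) := by
    refine tendsto_nhdsWithin_of_tendsto_nhds_of_eventually_within _ ?_ ?_
    · exact tendsto_nhdsWithin_of_tendsto_nhds ((continuous_sub_right s).tendsto' s 0 (sub_self s))
    · exact eventually_mem_nhdsWithin.mono fun s' hs' => by simpa [sub_eq_zero] using hs'
  have h1 := ((U s).continuous.tendsto (G f)).comp ((hU.slope f).comp hshift)
  refine h1.congr fun s' => ?_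
  simp only [Function.comp_apply, slope_def_module, ContinuousLinearMap.map_smul_of_tower, map_sub,
    ← hU.apply_add, add_sub_cancel]

variable {V : Type*} [NormedAddCommGroup V] [NormedSpace ℝ V]

/-- **Derivative of tested orbits**: `d/ds T (U s f) = T (U s (G f))`. [folklore] -/
theorem hasDerivAt_apply (hU : IsSmoothOneParam U G) (T : 𝓢(D, ℂ) →L[ℝ] V) (f : 𝓢(D, ℂ)) (s : ℝ) :
    HasDerivAt (fun s => T (U s f)) (T (U s (G f))) s :=
  hasDerivAt_clm_apply_of_tendsto_slope T (hU.tendsto_slope_apply f s)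

/-! ### Closure properties -/

/-- The constant family `U ≡ 1` with generator `0`. [folklore] -/
theorem const_id : IsSmoothOneParam (D := D) (fun _ => ContinuousLinearMap.id ℂ _) 0 where
  map_zero := rfl
  map_add _ _ := by rw [ContinuousLinearMap.id_comp]
  slope f := by simp
  bound := ⟨1, one_pos, (isSeminormBounded_singleton (ContinuousLinearMap.id ℂ 𝓢(D, ℂ))).mono (by
    rintro _ ⟨t, -, rfl⟩; exact Set.mem_singleton _)⟩

/-- Conjugating a smooth one-parameter family by a topological automorphism of `𝓢`. [folklore] -/
theorem conj (hU : IsSmoothOneParam U G) (A : 𝓢(D, ℂ) ≃L[ℂ] 𝓢(D, ℂ)) :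
    IsSmoothOneParam (fun s => (A : 𝓢(D, ℂ) →L[ℂ] 𝓢(D, ℂ)).comp ((U s).comp (A.symm : 𝓢(D, ℂ) →L[ℂ] 𝓢(D, ℂ))))
      ((A : 𝓢(D, ℂ) →L[ℂ] 𝓢(D, ℂ)).comp (G.comp (A.symm : 𝓢(D, ℂ) →L[ℂ] 𝓢(D, ℂ)))) where
  map_zero := by rw [hU.map_zero, ContinuousLinearMap.id_comp, ContinuousLinearEquiv.coe_comp_coe_symm]
  map_add s t := by
    ext f
    simp only [ContinuousLinearMap.coe_comp, Function.comp_apply, ContinuousLinearEquiv.coe_coe,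
      ContinuousLinearEquiv.symm_apply_apply, hU.apply_add]
  slope f := by
    have h1 := ((A : 𝓢(D, ℂ) →L[ℂ] 𝓢(D, ℂ)).continuous.tendsto _).comp (hU.slope (A.symm f))
    refine h1.congr fun h => ?_
    show (A : 𝓢(D, ℂ) →L[ℂ] 𝓢(D, ℂ)) (h⁻¹ • (U h (A.symm f) - A.symm f)) =
      h⁻¹ • ((A : 𝓢(D, ℂ) →L[ℂ] 𝓢(D, ℂ)) (U h ((A.symm : 𝓢(D, ℂ) →L[ℂ] 𝓢(D, ℂ)) f)) - f)
    rw [ContinuousLinearMap.map_smul_of_tower, map_sub, ContinuousLinearEquiv.coe_coe,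
      ContinuousLinearEquiv.coe_coe, ContinuousLinearEquiv.apply_symm_apply]
  bound := by
    refine ⟨1, one_pos, ?_⟩
    refine (((isSeminormBounded_singleton (A : 𝓢(D, ℂ) →L[ℂ] 𝓢(D, ℂ))).comp (hU.bound_Icc 1)).comp
      (isSeminormBounded_singleton (A.symm : 𝓢(D, ℂ) →L[ℂ] 𝓢(D, ℂ)))).mono ?_
    rintro _ ⟨t, ht, rfl⟩
    refine ⟨_, ⟨_, Set.mem_singleton _, U t, Set.mem_image_of_mem U ht, rfl⟩, _, Set.mem_singleton _, ?_⟩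
    show ((A : 𝓢(D, ℂ) →L[ℂ] 𝓢(D, ℂ)).comp (U t)).comp (A.symm : 𝓢(D, ℂ) →L[ℂ] 𝓢(D, ℂ)) = _
    rw [ContinuousLinearMap.comp_assoc]

/-- Linear reparametrisation `s ↦ U (c s)`, generator `c • G`. [folklore] -/
theorem rescale (hU : IsSmoothOneParam U G) (c : ℝ) : IsSmoothOneParam (fun s => U (c * s)) (c • G) := by
  refine ⟨by simpa using hU.map_zero, fun s t => by rw [mul_add, hU.map_add], fun f => ?_, ?_⟩
  · rcases eq_or_ne c 0 with rfl | hc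
    · rw [show ((0 : ℝ) • G) f = 0 by simp]
      simp only [zero_mul, hU.apply_zero, sub_self, smul_zero]
      exact tendsto_const_nhds
    · have hmul : Tendsto (fun h : ℝ => c * h) (𝓝[≠] 0) (𝓝[≠] 0) := by
        refine tendsto_nhdsWithin_of_tendsto_nhds_of_eventually_within _ ?_ ?_
        · exact tendsto_nhdsWithin_of_tendsto_nhds ((continuous_const_mul c).tendsto' 0 0 (mul_zero c))
        · exact eventually_mem_nhdsWithin.mono fun h hh => by
            simpa using mul_ne_zero hc (by simpa using hh)
      have h1 := ((hU.slope f).comp hmul).const_smul c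
      rw [show (c • G) f = c • G f from rfl]
      refine h1.congr' (eventually_mem_nhdsWithin.mono fun h hh => ?_)
      have hh' : (h : ℝ) ≠ 0 := by simpa using hh
      simp only [Function.comp_apply, smul_smul, mul_inv_rev]
      congr 1
      field_simp
  · -- bounds: `c s ∈ [-|c|, |c|]` for `|s| ≤ 1`
    refine ⟨1, one_pos, (hU.bound_Icc |c|).mono ?_⟩
    rintro _ ⟨s, hs, rfl⟩
    have h : |c * s| ≤ |c| := by
      rw [abs_mul]; exact mul_le_of_le_one_right (abs_nonneg c) (abs_le.mpr ⟨hs.1, hs.2⟩)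
    exact Set.mem_image_of_mem U (abs_le.mp h)

/-- Unitary phase twist `s ↦ e^{ias} U s`, generator `(ia) • 1 + G`. [folklore] -/
theorem phase (hU : IsSmoothOneParam U G) (a : ℝ) :
    IsSmoothOneParam (fun s => Complex.exp ((a * s : ℝ) * Complex.I) • U s)
      (((a : ℂ) * Complex.I) • ContinuousLinearMap.id ℂ _ + G) := by
  refine ⟨?_, fun s t => ?_, fun f => ?_, ?_⟩
  · simp [hU.map_zero]
  · rw [ContinuousLinearMap.smul_comp, ContinuousLinearMap.comp_smul, smul_smul, ← Complex.exp_add,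
      ← hU.map_add]
    have : (((a * (s + t) : ℝ) : ℂ) * Complex.I) = ((a * s : ℝ) : ℂ) * Complex.I + ((a * t : ℝ) : ℂ) * Complex.I := by
      push_cast; ring
    rw [this]
  · -- `h⁻¹ (e^{iah} U h f - f) = (h⁻¹ (e^{iah} - 1)) • U h f + h⁻¹ (U h f - f)`
    set φ : ℝ → ℂ := fun h => Complex.exp ((a * h : ℝ) * Complex.I) with hφ
    have he : HasDerivAt φ ((a : ℂ) * Complex.I) 0 := by
      have h1 : HasDerivAt (fun h : ℝ => ((a * h : ℝ) : ℂ) * Complex.I) (((a * 1 : ℝ) : ℂ) * Complex.I) 0 :=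
        ((hasDerivAt_id' (0 : ℝ)).const_mul a).ofReal_comp.mul_const Complex.I
      refine h1.cexp.congr_deriv ?_
      simp
    have hφ0 : φ 0 = 1 := by simp [hφ]
    have he' : Tendsto (fun h : ℝ => h⁻¹ • (φ h - 1)) (𝓝[≠] 0) (𝓝 ((a : ℂ) * Complex.I)) := by
      have := he.tendsto_slope_zero
      simpa only [zero_add, hφ0] using this
    have hUf : Tendsto (fun h : ℝ => U h f) (𝓝[≠] 0) (𝓝 f) :=
      tendsto_nhdsWithin_of_tendsto_nhds (hU.tendsto_apply_zero f)
    have h2 := (he'.smul hUf).add (hU.slope f)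
    have h3 : (((a : ℂ) * Complex.I) • ContinuousLinearMap.id ℂ 𝓢(D, ℂ) + G) f =
        ((a : ℂ) * Complex.I) • f + G f := by simp
    rw [h3]
    refine h2.congr' (eventually_mem_nhdsWithin.mono fun h _ => ?_)
    show (h⁻¹ • (φ h - 1)) • U h f + h⁻¹ • (U h f - f) = h⁻¹ • ((φ h • U h) f - f)
    rw [show (φ h • U h) f = φ h • U h f from rfl, smul_assoc, sub_smul, one_smul, ← smul_add,
      sub_add_sub_cancel]
  · refine ⟨1, one_pos, (hU.bound_Icc 1).unitSMul.mono ?_⟩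
    rintro _ ⟨s, hs, rfl⟩
    refine ⟨_, ?_, U s, Set.mem_image_of_mem U hs, rfl⟩
    rw [Complex.norm_exp_ofReal_mul_I]

end IsSmoothOneParam

end OneParam

section Words

variable (D) in
/-- A **smooth letter**: fixed operators `pre`, `post` around a smooth one-parameter family `fam` with generator
`gen`; it acts at time `s` by `pre ∘ fam s ∘ post`. [folklore] -/
structure SmoothLetter where
  /-- fixed left factor -/
  pre : 𝓢(D, ℂ) →L[ℂ] 𝓢(D, ℂ)
  /-- the one-parameter family -/
  fam : ℝ → 𝓢(D, ℂ) →L[ℂ] 𝓢(D, ℂ)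
  /-- its generator -/
  gen : 𝓢(D, ℂ) →L[ℂ] 𝓢(D, ℂ)
  /-- fixed right factor -/
  post : 𝓢(D, ℂ) →L[ℂ] 𝓢(D, ℂ)
  smooth : IsSmoothOneParam fam gen

namespace SmoothLetter

/-- The operator of the letter at time `s`. [folklore] -/
def op (ℓ : SmoothLetter D) (s : ℝ) : 𝓢(D, ℂ) →L[ℂ] 𝓢(D, ℂ) := ℓ.pre.comp ((ℓ.fam s).comp ℓ.post)

/-- The derived letter: `post` is replaced by `gen ∘ post`. [folklore] -/
def deriv (ℓ : SmoothLetter D) : SmoothLetter D := { ℓ with post := ℓ.gen.comp ℓ.post }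

/-- `ℓ.op s f = ℓ.pre (ℓ.fam s (ℓ.post f))`. [folklore] -/
@[simp] theorem op_apply (ℓ : SmoothLetter D) (s : ℝ) (f : 𝓢(D, ℂ)) :
    ℓ.op s f = ℓ.pre (ℓ.fam s (ℓ.post f)) := rfl

/-- `ℓ.deriv.op s f = ℓ.pre (ℓ.fam s (ℓ.gen (ℓ.post f)))`. [folklore] -/
@[simp] theorem deriv_op_apply (ℓ : SmoothLetter D) (s : ℝ) (f : 𝓢(D, ℂ)) :
    ℓ.deriv.op s f = ℓ.pre (ℓ.fam s (ℓ.gen (ℓ.post f))) := rfl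

/-- The letter of a smooth one-parameter family. [folklore] -/
def ofFamily {U : ℝ → 𝓢(D, ℂ) →L[ℂ] 𝓢(D, ℂ)} {G : 𝓢(D, ℂ) →L[ℂ] 𝓢(D, ℂ)} (hU : IsSmoothOneParam U G) :
    SmoothLetter D :=
  ⟨ContinuousLinearMap.id ℂ _, U, G, ContinuousLinearMap.id ℂ _, hU⟩

/-- The letter of a bare family acts by the family: `(ofFamily hU).op s = U s`. [folklore] -/
@[simp] theorem ofFamily_op {U : ℝ → 𝓢(D, ℂ) →L[ℂ] 𝓢(D, ℂ)} {G : 𝓢(D, ℂ) →L[ℂ] 𝓢(D, ℂ)}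
    (hU : IsSmoothOneParam U G) (s : ℝ) : (ofFamily hU).op s = U s := by
  ext f; rfl

/-- The constant letter of a fixed operator (trivial family). [folklore] -/
def const (A : 𝓢(D, ℂ) →L[ℂ] 𝓢(D, ℂ)) : SmoothLetter D :=
  ⟨A, fun _ => ContinuousLinearMap.id ℂ _, 0, ContinuousLinearMap.id ℂ _, IsSmoothOneParam.const_id⟩

/-- A constant letter acts by its constant: `(const A).op s = A`. [folklore] -/
@[simp] theorem const_op (A : 𝓢(D, ℂ) →L[ℂ] 𝓢(D, ℂ)) (s : ℝ) : (const A).op s = A := by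
  ext f; rfl

/-- Joint continuity of `(x ↦ ℓ.op (σ x) (g x))` along continuous `σ`, `g`. [folklore] -/
theorem continuous_op_apply₂ (ℓ : SmoothLetter D) {X : Type*} [TopologicalSpace X] {σ : X → ℝ}
    {Ψ : X → 𝓢(D, ℂ)} (hσ : Continuous σ) (hΨ : Continuous Ψ) : Continuous fun x => ℓ.op (σ x) (Ψ x) := by
  simp only [op_apply]
  exact ℓ.pre.continuous.comp (ℓ.smooth.continuous_apply₂ hσ (ℓ.post.continuous.comp hΨ))

variable {V : Type*} [NormedAddCommGroup V] [NormedSpace ℝ V]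

/-- The derivative of `s ↦ T (ℓ.op s f)` is `T (ℓ.deriv.op s f)`. [folklore] -/
theorem hasDerivAt_op_apply (ℓ : SmoothLetter D) (T : 𝓢(D, ℂ) →L[ℝ] V) (f : 𝓢(D, ℂ)) (s : ℝ) :
    HasDerivAt (fun s => T (ℓ.op s f)) (T (ℓ.deriv.op s f)) s := by
  simp only [op_apply]
  exact ℓ.smooth.hasDerivAt_apply (T.comp (ℓ.pre.restrictScalars ℝ)) (ℓ.post f) s

end SmoothLetter

/-- The operator of a word `w` of smooth letters at times `t`: the ordered product `∏ᵢ (w i).op (t i)`. [folklore] -/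
def wordOp : (n : ℕ) → (Fin n → SmoothLetter D) → (Fin n → ℝ) → (𝓢(D, ℂ) →L[ℂ] 𝓢(D, ℂ))
  | 0, _, _ => ContinuousLinearMap.id ℂ _
  | n + 1, w, t => ((w 0).op (t 0)).comp (wordOp n (Fin.tail w) (Fin.tail t))

/-- The empty word acts as the identity. [folklore] -/
@[simp] theorem wordOp_zero (w : Fin 0 → SmoothLetter D) (t : Fin 0 → ℝ) :
    wordOp 0 w t = ContinuousLinearMap.id ℂ _ := rfl

/-- Unfolding a word at its first letter: `wordOp (n+1) w t = (w 0).op (t 0) ∘ wordOp n (tail w) (tail t)`. [folklore] -/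
theorem wordOp_succ {n : ℕ} (w : Fin (n + 1) → SmoothLetter D) (t : Fin (n + 1) → ℝ) :
    wordOp (n + 1) w t = ((w 0).op (t 0)).comp (wordOp n (Fin.tail w) (Fin.tail t)) := rfl

/-- Unfolding a word at its first letter, applied to a vector. [folklore] -/
theorem wordOp_succ_apply {n : ℕ} (w : Fin (n + 1) → SmoothLetter D) (t : Fin (n + 1) → ℝ) (f : 𝓢(D, ℂ)) :
    wordOp (n + 1) w t f = (w 0).op (t 0) (wordOp n (Fin.tail w) (Fin.tail t) f) := rfl

/-- `Fin.tail` is continuous on `Fin (n+1) → ℝ`. [folklore] -/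
private theorem continuous_tail (n : ℕ) : Continuous (Fin.tail : (Fin (n + 1) → ℝ) → Fin n → ℝ) :=
  continuous_pi fun i => continuous_apply i.succ

/-- Word operators act jointly continuously in (times, vector). [folklore] -/
theorem continuous_wordOp_apply₂ : ∀ (n : ℕ) (w : Fin n → SmoothLetter D) {X : Type*} [TopologicalSpace X]
    {τ : X → Fin n → ℝ} {Ψ : X → 𝓢(D, ℂ)} (_ : Continuous τ) (_ : Continuous Ψ),
    Continuous fun x => wordOp n w (τ x) (Ψ x)
  | 0, _, _, _, _, _, _, hΨ => by simpa using hΨ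
  | n + 1, w, X, _, τ, Ψ, hτ, hΨ => by
      simp only [wordOp_succ_apply]
      exact (w 0).continuous_op_apply₂ ((continuous_apply 0).comp hτ)
        (continuous_wordOp_apply₂ n (Fin.tail w) ((continuous_tail n).comp hτ) hΨ)

/-- Strong continuity of a word: `t ↦ wordOp n w t Φ` is continuous. [folklore] -/
theorem continuous_wordOp_apply (n : ℕ) (w : Fin n → SmoothLetter D) (Φ : 𝓢(D, ℂ)) :
    Continuous fun t => wordOp n w t Φ :=
  continuous_wordOp_apply₂ n w continuous_id continuous_const

/-- Updating a later letter does not change the first one. [folklore] -/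
private theorem update_succ_apply_zero {α : Type*} {n : ℕ} (w : Fin (n + 1) → α) (i : Fin n) (x : α) :
    Function.update w i.succ x 0 = w 0 :=
  Function.update_of_ne (Fin.succ_ne_zero i).symm x w

variable {V : Type*} [NormedAddCommGroup V] [NormedSpace ℝ V]

/-- The Fréchet derivative of `t ↦ T (wordOp n w t Φ)`: `v ↦ ∑ᵢ vᵢ • T (wordOp n w⁽ⁱ⁾ t Φ)`, `w⁽ⁱ⁾` the word with
its `i`-th letter derived. [folklore] -/
def wordFDeriv (n : ℕ) (w : Fin n → SmoothLetter D) (T : 𝓢(D, ℂ) →L[ℝ] V) (Φ : 𝓢(D, ℂ)) (t : Fin n → ℝ) :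
    (Fin n → ℝ) →L[ℝ] V :=
  ∑ i : Fin n, (ContinuousLinearMap.proj i : (Fin n → ℝ) →L[ℝ] ℝ).smulRight
    (T (wordOp n (Function.update w i (w i).deriv) t Φ))

/-- The candidate derivative evaluated on a vector: `wordFDeriv n w T Φ t v = ∑ i, v i • T (wordOp n (update w i (w i).deriv) t Φ)`. [folklore] -/
theorem wordFDeriv_apply (n : ℕ) (w : Fin n → SmoothLetter D) (T : 𝓢(D, ℂ) →L[ℝ] V) (Φ : 𝓢(D, ℂ))
    (t v : Fin n → ℝ) :
    wordFDeriv n w T Φ t v = ∑ i : Fin n, v i • T (wordOp n (Function.update w i (w i).deriv) t Φ) := by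
  simp [wordFDeriv]

/-- **Differentiability of tested word maps.**  For every continuous real-linear `T : 𝓢 → V`, every `Φ ∈ 𝓢`
and every word `w` of smooth letters, `t ↦ T (wordOp n w t Φ)` is Fréchet differentiable on `ℝⁿ` with derivative
`wordFDeriv n w T Φ t`. [folklore] -/
theorem hasFDerivAt_wordOp_apply (Φ : 𝓢(D, ℂ)) : ∀ (n : ℕ) (w : Fin n → SmoothLetter D)
    (T : 𝓢(D, ℂ) →L[ℝ] V) (t : Fin n → ℝ),
    HasFDerivAt (fun t => T (wordOp n w t Φ)) (wordFDeriv n w T Φ t) t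
  | 0, w, T, t => by
      have h0 : wordFDeriv 0 w T Φ t = 0 := by simp [wordFDeriv]
      rw [h0]
      exact hasFDerivAt_const (T Φ) t
  | n + 1, w, T, t => by
      -- split `ℝⁿ⁺¹ = ℝ × ℝⁿ` along `Fin.consEquivL`
      let e := Fin.consEquivL ℝ (fun _ : Fin (n + 1) => ℝ)
      have he : ∀ u : Fin (n + 1) → ℝ, e.symm u = (u 0, Fin.tail u) := fun _ => rfl
      let g : ℝ → (Fin n → ℝ) → V := fun s u => T ((w 0).op s (wordOp n (Fin.tail w) u Φ))
      let f₁ : ℝ → (Fin n → ℝ) → (ℝ →L[ℝ] V) := fun s u =>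
        (1 : ℝ →L[ℝ] ℝ).smulRight (T ((w 0).deriv.op s (wordOp n (Fin.tail w) u Φ)))
      let f₂ : ℝ → (Fin n → ℝ) → ((Fin n → ℝ) →L[ℝ] V) := fun s u =>
        wordFDeriv n (Fin.tail w) (T.comp (((w 0).op s).restrictScalars ℝ)) Φ u
      have df₁ : ∀ v : ℝ × (Fin n → ℝ), HasFDerivAt (fun s => g s v.2) (f₁ v.1 v.2) v.1 := fun v =>
        ((w 0).hasDerivAt_op_apply T (wordOp n (Fin.tail w) v.2 Φ) v.1).hasFDerivAt
      have df₂ : ∀ v : ℝ × (Fin n → ℝ), HasFDerivAt (fun u => g v.1 u) (f₂ v.1 v.2) v.2 := fun v =>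
        hasFDerivAt_wordOp_apply Φ n (Fin.tail w) (T.comp (((w 0).op v.1).restrictScalars ℝ)) v.2
      have cf₁ : Continuous ↿f₁ := by
        have hc : Continuous fun v : ℝ × (Fin n → ℝ) =>
            T ((w 0).deriv.op v.1 (wordOp n (Fin.tail w) v.2 Φ)) :=
          T.continuous.comp ((w 0).deriv.continuous_op_apply₂ continuous_fst
            ((continuous_wordOp_apply n (Fin.tail w) Φ).comp continuous_snd))
        exact ((ContinuousLinearMap.smulRightL ℝ ℝ V (1 : ℝ →L[ℝ] ℝ)).continuous.comp hc).congr
          fun v => rfl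
      have cf₂ : Continuous ↿f₂ := by
        have : ↿f₂ = fun v : ℝ × (Fin n → ℝ) => ∑ i : Fin n,
            (ContinuousLinearMap.proj i : (Fin n → ℝ) →L[ℝ] ℝ).smulRight
              (T ((w 0).op v.1 (wordOp n (Function.update (Fin.tail w) i (Fin.tail w i).deriv) v.2 Φ))) := by
          funext v; rfl
        rw [this]
        refine continuous_finsetSum _ fun i _ => ?_
        have hc : Continuous fun v : ℝ × (Fin n → ℝ) =>
            T ((w 0).op v.1 (wordOp n (Function.update (Fin.tail w) i (Fin.tail w i).deriv) v.2 Φ)) :=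
          T.continuous.comp ((w 0).continuous_op_apply₂ continuous_fst
            ((continuous_wordOp_apply n _ Φ).comp continuous_snd))
        exact ((ContinuousLinearMap.smulRightL ℝ (Fin n → ℝ) V
          (ContinuousLinearMap.proj i : (Fin n → ℝ) →L[ℝ] ℝ)).continuous.comp hc).congr fun v => rfl
      have H := hasStrictFDerivAt_uncurry_coprod (f := g) (u := (t 0, Fin.tail t))
        (Eventually.of_forall df₁) (Eventually.of_forall df₂) cf₁.continuousAt cf₂.continuousAt
      have H1 : HasFDerivAt (fun p : ℝ × (Fin n → ℝ) => g p.1 p.2)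
          ((f₁ (t 0) (Fin.tail t)).coprod (f₂ (t 0) (Fin.tail t))) (e.symm t) := H.hasFDerivAt
      have H2 := H1.comp t (e.symm : (Fin (n + 1) → ℝ) →L[ℝ] ℝ × (Fin n → ℝ)).hasFDerivAt
      have H3 : HasFDerivAt (fun u => T (wordOp (n + 1) w u Φ))
          (((f₁ (t 0) (Fin.tail t)).coprod (f₂ (t 0) (Fin.tail t))).comp
            (e.symm : (Fin (n + 1) → ℝ) →L[ℝ] ℝ × (Fin n → ℝ))) t := H2
      refine H3.congr_fderiv (ContinuousLinearMap.ext fun v => ?_)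
      rw [ContinuousLinearMap.comp_apply, ContinuousLinearEquiv.coe_coe, he, ContinuousLinearMap.coprod_apply,
        wordFDeriv_apply (n + 1) w T Φ t v, Fin.sum_univ_succ]
      -- the `0`-th summands agree definitionally (`Function.update_self`, `Fin.tail_update_zero` are `rfl`
      -- after unfolding); `congr 1` closes them and leaves the remaining coordinates
      congr 1
      simp only [f₂, wordFDeriv_apply, ContinuousLinearMap.coe_comp, Function.comp_apply,
        ContinuousLinearMap.coe_restrictScalars', wordOp_succ_apply, Fin.tail_update_succ,
        update_succ_apply_zero, Fin.tail]

/-- `t ↦ T (wordOp n w t Φ)` is differentiable. [folklore] -/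
theorem differentiable_wordOp_apply (n : ℕ) (w : Fin n → SmoothLetter D) (T : 𝓢(D, ℂ) →L[ℝ] V)
    (Φ : 𝓢(D, ℂ)) : Differentiable ℝ fun t => T (wordOp n w t Φ) := fun t =>
  (hasFDerivAt_wordOp_apply Φ n w T t).differentiableAt

/-- `fderiv` of `t ↦ T (wordOp n w t Φ)` is `wordFDeriv n w T Φ`. [folklore] -/
theorem fderiv_wordOp_apply (n : ℕ) (w : Fin n → SmoothLetter D) (T : 𝓢(D, ℂ) →L[ℝ] V) (Φ : 𝓢(D, ℂ)) :
    fderiv ℝ (fun t => T (wordOp n w t Φ)) = wordFDeriv n w T Φ :=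
  funext fun t => (hasFDerivAt_wordOp_apply Φ n w T t).fderiv

/-- `C^k` for every finite `k`, by the bootstrap "the partial derivatives are again tested word maps". [folklore] -/
theorem contDiff_wordOp_apply_nat (Φ : 𝓢(D, ℂ)) : ∀ (k : ℕ) (n : ℕ) (w : Fin n → SmoothLetter D)
    (T : 𝓢(D, ℂ) →L[ℝ] V), ContDiff ℝ k fun t => T (wordOp n w t Φ)
  | 0, n, w, T => contDiff_zero.2 (T.continuous.comp (continuous_wordOp_apply n w Φ))
  | k + 1, n, w, T => by
      rw [show ((k + 1 : ℕ) : WithTop ℕ∞) = (k : WithTop ℕ∞) + 1 by push_cast; rfl,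
        contDiff_succ_iff_fderiv]
      refine ⟨differentiable_wordOp_apply n w T Φ, fun h => (WithTop.natCast_ne_top k h).elim, ?_⟩
      rw [fderiv_wordOp_apply]
      unfold wordFDeriv
      exact ContDiff.sum fun i _ => contDiff_const.smulRight (contDiff_wordOp_apply_nat Φ k n _ T)

/-- **Smoothness of tested word maps**: `t ↦ T (wordOp n w t Φ)` is `C^∞` on `ℝⁿ`. [folklore] -/
theorem contDiff_wordOp_apply (n : ℕ) (w : Fin n → SmoothLetter D) (T : 𝓢(D, ℂ) →L[ℝ] V) (Φ : 𝓢(D, ℂ)) :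
    ContDiff ℝ ∞ fun t => T (wordOp n w t Φ) :=
  contDiff_infty.2 fun k => contDiff_wordOp_apply_nat Φ k n w T

/-- Tested word maps composed with a `C^∞` chart `τ` are `C^∞` (the form used with coordinates of the second kind
`g = ∏ exp (τᵢ(g) Xᵢ)`). [folklore] -/
theorem contDiffAt_wordOp_comp (n : ℕ) (w : Fin n → SmoothLetter D) (T : 𝓢(D, ℂ) →L[ℝ] V) (Φ : 𝓢(D, ℂ))
    {B : Type*} [NormedAddCommGroup B] [NormedSpace ℝ B] {τ : B → Fin n → ℝ} {b₀ : B} {m : WithTop ℕ∞}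
    (hm : m ≤ ∞) (hτ : ContDiffAt ℝ m τ b₀) :
    ContDiffAt ℝ m (fun b => T (wordOp n w (τ b) Φ)) b₀ :=
  ((contDiff_wordOp_apply n w T Φ).of_le hm).contDiffAt.comp b₀ hτ

/-- Differentiability of `b ↦ T (wordOp n w (τ b) Φ)` at a point where `τ` is differentiable (chain rule). [folklore] -/
theorem differentiableAt_wordOp_comp (n : ℕ) (w : Fin n → SmoothLetter D) (T : 𝓢(D, ℂ) →L[ℝ] V) (Φ : 𝓢(D, ℂ))
    {B : Type*} [NormedAddCommGroup B] [NormedSpace ℝ B] {τ : B → Fin n → ℝ} {b₀ : B}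
    (hτ : DifferentiableAt ℝ τ b₀) : DifferentiableAt ℝ (fun b => T (wordOp n w (τ b) Φ)) b₀ :=
  ((differentiable_wordOp_apply n w T Φ) (τ b₀)).comp b₀ hτ

end Words

end Literature.Analysis.SegalBargmann

end
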